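import Mathlib
import Summits.Ventures.PercRepro2.HCov
import Summits.Ventures.PercRepro2.HCovSwap
import Summits.Ventures.PercRepro2.RECMReduction
import Summits.Ventures.PercRepro2.GcTransport
import Summits.Ventures.PercRepro2.CutVertexPaths
import Summits.Ventures.PercRepro2.CutOneFar
import Summits.Ventures.PercRepro2.CutOneFarMarked
import Summits.Ventures.PercRepro2.PendantRootAll
import Summits.Ventures.PercRepro2.PendantRootReduction
import Summits.Ventures.PercRepro2.LeafMarkReduction
import Summits.Ventures.PercRepro2.LeafMarkAny

/-!
# One of `a₁, a₂, o, b` alone behind a cut vertex: (HCOV) from the right side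
(blind cell PercRepro2, p5 g24; `proofs/P5-OEDGE.md` §30 addendum 3)

typer-1 g48's one-far-mark equivalence (`CutOneFar.Gc_eq_reduced`) replaces the side of a cut vertex
`v` that carries a single mark `w` by a pendant edge `{v, w}` of weight `P(w ↔ v by left edges)`.
With the leaf theorems of this seat the reduced pendant graph is decided for `w ∈ {a₁, a₂, o, b}`:

* `v` UNMARKED — (HCOV) on `G` follows from (HCOV) on the RIGHT SIDE with `w` moved to `v`
  (for a root: the contraction of the pendant edge, `HCov_pendant_root_contract`; for `o`, `b`: the
  pendant edge re-pointed to a loop and the mark relocated, `HCov_leaf_o_loop` / `HCov_leaf_b_loop`):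
  **`HCov_a2_behind_unmarked`**, **`HCov_a1_behind_unmarked`**, **`HCov_o_behind_unmarked`**,
  **`HCov_b_behind_unmarked`**;
* `v` a MARK — (HCOV) outright (`LeafMarkAny.HCov_leaf_at_mark`): **`HCov_mark_behind_mark`**.

So the one-far-mark table is closed for four of the five marks: a mark among `a₁, a₂, o, b` separated
alone by a cut vertex reduces to the right side (or vanishes); `a₃` alone behind an unmarked cut
vertex remains the cut-vertex form of the open row (LEAF-½).
-/

namespace Summit.Ventures.PercRepro2

open CovForm CovForm.FirstOrder CutVertexM9 CutOneFar RECM LeafRoot LeafMark LeafMarkAny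

namespace CutOneFarAny

section Unmarked

variable {V : Type*} {E : Type*} [Fintype E] [DecidableEq E] [Fintype V] [DecidableEq V]
  {R : Type*} [Field R] [LinearOrder R] [IsStrictOrderedRing R]
variable {ends : E → Sym2 V} {side : E → Bool} {L : Set V} {v : V} {Rt : Set V} {w : V}

omit [Fintype E] [DecidableEq E] [Fintype V] [DecidableEq V] in
/-- A right vertex is not the cut vertex. -/
lemma right_ne_cut (h : CutVertex ends side L v Rt) {z : V} (hz : z ∈ Rt) : z ≠ v :=
  fun hzv => h.vR (hzv ▸ hz)

omit [Fintype E] [DecidableEq E] [Fintype V] [DecidableEq V] in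
/-- The cut vertex is unmarked when the marks are the far mark and right vertices. -/
lemma unmarked_cut (h : CutVertex ends side L v Rt) {o a₁ a₂ a₃ b : V}
    (ho : o ∈ Rt ∨ o ∈ L) (h1 : a₁ ∈ Rt ∨ a₁ ∈ L) (h2 : a₂ ∈ Rt ∨ a₂ ∈ L) (h3 : a₃ ∈ Rt ∨ a₃ ∈ L)
    (hb : b ∈ Rt ∨ b ∈ L) : Unmarked o a₁ a₂ a₃ b v := by
  have key : ∀ z, z ∈ Rt ∨ z ∈ L → v ≠ z := by
    rintro z (hz | hz) rfl
    · exact h.vR hz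
    · exact h.vL hz
  exact ⟨key o ho, key a₁ h1, key a₂ h2, key a₃ h3, key b hb⟩

/-- **The root `a₂` alone behind an UNMARKED cut vertex `v`**: (HCOV) on `G` from (HCOV) on the right
side with `a₂` moved to `v` (the reduced pendant graph with its pendant edge contracted). -/
theorem HCov_a2_behind_unmarked (h : CutVertex ends side L v Rt) {p : E → R} (hp : IsProbVec p)
    {o a₁ a₂ a₃ b : V} (hw : a₂ ∈ L) (ho : o ∈ Rt) (h1 : a₁ ∈ Rt) (h3 : a₃ ∈ Rt) (hb : b ∈ Rt)
    (hred : HCov (rweights side p (leftProb ends side v a₂ p))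
      (contractRootEdge (rends ends side v a₂) a₂ v) o a₁ a₂ a₃ b) :
    HCov p ends o a₁ a₂ a₃ b := by
  refine HCov_of_reduced h hw p o a₁ a₂ a₃ b ?_ ?_
  · intro m hm
    simp only [Set.mem_insert_iff, Set.mem_singleton_iff] at hm
    rcases hm with rfl | rfl | rfl | rfl | rfl
    · exact Or.inr (Or.inl ho)
    · exact Or.inr (Or.inl h1)
    · exact Or.inl rfl
    · exact Or.inr (Or.inl h3)
    · exact Or.inr (Or.inl hb)
  · exact HCov_pendant_root_contract _ (isProbVec_rweights_leftProb ends side v a₂ hp)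
      (rends_pendant ends side v a₂) (leaf_reduced h hw)
      (unmarked_cut h (Or.inl ho) (Or.inl h1) (Or.inr hw) (Or.inl h3) (Or.inl hb))
      (far_ne_right h hw (Or.inl ho)).symm (far_ne_right h hw (Or.inl h1)).symm
      (far_ne_right h hw (Or.inl h3)).symm (far_ne_right h hw (Or.inl hb)).symm hred

/-- **The root `a₁` alone behind an UNMARKED cut vertex `v`**: the mirror. -/
theorem HCov_a1_behind_unmarked (h : CutVertex ends side L v Rt) {p : E → R} (hp : IsProbVec p)
    {o a₁ a₂ a₃ b : V} (hw : a₁ ∈ L) (ho : o ∈ Rt) (h2 : a₂ ∈ Rt) (h3 : a₃ ∈ Rt) (hb : b ∈ Rt)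
    (hred : HCov (rweights side p (leftProb ends side v a₁ p))
      (contractRootEdge (rends ends side v a₁) a₁ v) o a₁ a₂ a₃ b) :
    HCov p ends o a₁ a₂ a₃ b := by
  refine HCov_of_reduced h hw p o a₁ a₂ a₃ b ?_ ?_
  · intro m hm
    simp only [Set.mem_insert_iff, Set.mem_singleton_iff] at hm
    rcases hm with rfl | rfl | rfl | rfl | rfl
    · exact Or.inr (Or.inl ho)
    · exact Or.inl rfl
    · exact Or.inr (Or.inl h2)
    · exact Or.inr (Or.inl h3)
    · exact Or.inr (Or.inl hb)
  · exact HCov_pendant_root_contract' _ (isProbVec_rweights_leftProb ends side v a₁ hp)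
      (rends_pendant ends side v a₁) (leaf_reduced h hw)
      (unmarked_cut h (Or.inl ho) (Or.inr hw) (Or.inl h2) (Or.inl h3) (Or.inl hb))
      (far_ne_right h hw (Or.inl ho)).symm (far_ne_right h hw (Or.inl h2)).symm
      (far_ne_right h hw (Or.inl h3)).symm (far_ne_right h hw (Or.inl hb)).symm hred

omit [Fintype V] [DecidableEq V] in
/-- **`o` alone behind an UNMARKED cut vertex `v`**: (HCOV) on `G` from (HCOV) on the right side with
`o` moved to `v` (the reduced pendant graph with its pendant edge re-pointed to a loop). -/
theorem HCov_o_behind_unmarked (h : CutVertex ends side L v Rt) {p : E → R} (hp : IsProbVec p)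
    {o a₁ a₂ a₃ b : V} (hw : o ∈ L) (h1 : a₁ ∈ Rt) (h2 : a₂ ∈ Rt) (h3 : a₃ ∈ Rt) (hb : b ∈ Rt)
    (hred : HCov (rweights side p (leftProb ends side v o p))
      (Function.update (rends ends side v o) (Sum.inr ()) s(o, o)) v a₁ a₂ a₃ b) :
    HCov p ends o a₁ a₂ a₃ b := by
  refine HCov_of_reduced h hw p o a₁ a₂ a₃ b ?_ ?_
  · intro m hm
    simp only [Set.mem_insert_iff, Set.mem_singleton_iff] at hm
    rcases hm with rfl | rfl | rfl | rfl | rfl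
    · exact Or.inl rfl
    · exact Or.inr (Or.inl h1)
    · exact Or.inr (Or.inl h2)
    · exact Or.inr (Or.inl h3)
    · exact Or.inr (Or.inl hb)
  · exact HCov_leaf_o_loop _ (isProbVec_rweights_leftProb ends side v o hp)
      (rends_pendant ends side v o) (leaf_reduced h hw)
      (unmarked_cut h (Or.inr hw) (Or.inl h1) (Or.inl h2) (Or.inl h3) (Or.inl hb))
      (far_ne_right h hw (Or.inl h1)) (far_ne_right h hw (Or.inl h2))
      (far_ne_right h hw (Or.inl h3)) (far_ne_right h hw (Or.inl hb)) hred

omit [Fintype V] [DecidableEq V] in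
/-- **`b` alone behind an UNMARKED cut vertex `v`**: (HCOV) on `G` from (HCOV) on the right side with
`b` moved to `v`. -/
theorem HCov_b_behind_unmarked (h : CutVertex ends side L v Rt) {p : E → R} (hp : IsProbVec p)
    {o a₁ a₂ a₃ b : V} (hw : b ∈ L) (ho : o ∈ Rt) (h1 : a₁ ∈ Rt) (h2 : a₂ ∈ Rt) (h3 : a₃ ∈ Rt)
    (hred : HCov (rweights side p (leftProb ends side v b p))
      (Function.update (rends ends side v b) (Sum.inr ()) s(b, b)) o a₁ a₂ a₃ v) :
    HCov p ends o a₁ a₂ a₃ b := by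
  refine HCov_of_reduced h hw p o a₁ a₂ a₃ b ?_ ?_
  · intro m hm
    simp only [Set.mem_insert_iff, Set.mem_singleton_iff] at hm
    rcases hm with rfl | rfl | rfl | rfl | rfl
    · exact Or.inr (Or.inl ho)
    · exact Or.inr (Or.inl h1)
    · exact Or.inr (Or.inl h2)
    · exact Or.inr (Or.inl h3)
    · exact Or.inl rfl
  · exact HCov_leaf_b_loop _ (isProbVec_rweights_leftProb ends side v b hp)
      (rends_pendant ends side v b) (leaf_reduced h hw)
      (unmarked_cut h (Or.inl ho) (Or.inl h1) (Or.inl h2) (Or.inl h3) (Or.inr hw))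
      (far_ne_right h hw (Or.inl ho)) (far_ne_right h hw (Or.inl h1))
      (far_ne_right h hw (Or.inl h2)) (far_ne_right h hw (Or.inl h3)) hred

end Unmarked

section Marked

variable {V : Type*} {E : Type*} [Fintype E] [DecidableEq E] [Fintype V] [DecidableEq V]
  {R : Type*} [Field R] [LinearOrder R] [IsStrictOrderedRing R]
variable {ends : E → Sym2 V} {side : E → Bool} {L : Set V} {v : V} {Rt : Set V}

/-- **One of `a₁, a₂, o, b` alone behind a cut vertex that is a MARK**: (HCOV) outright (the reduced
pendant graph has the far mark as a leaf at a mark). -/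
theorem HCov_mark_behind_mark (h : CutVertex ends side L v Rt) {p : E → R} (hp : IsProbVec p)
    {o a₁ a₂ a₃ b w : V} (hw : w ∈ L) (hwm : w = a₁ ∨ w = a₂ ∨ w = o ∨ w = b)
    (hv : v = o ∨ v = a₁ ∨ v = a₂ ∨ v = a₃ ∨ v = b)
    (hM : ∀ m ∈ ({o, a₁, a₂, a₃, b} : Set V), m = w ∨ m ∈ Rt ∨ m = v)
    (h12 : a₁ ≠ a₂) (h13 : a₁ ≠ a₃) (h23 : a₂ ≠ a₃) (ho1 : o ≠ a₁) (ho2 : o ≠ a₂) (ho3 : o ≠ a₃)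
    (hob : o ≠ b) (hb1 : b ≠ a₁) (hb2 : b ≠ a₂) (hb3 : b ≠ a₃) :
    HCov p ends o a₁ a₂ a₃ b := by
  refine HCov_of_reduced h hw p o a₁ a₂ a₃ b hM ?_
  have hleaf := leaf_reduced h hw
  have hpend := rends_pendant ends side v w
  have hne := far_ne_cut h hw
  refine HCov_leaf_at_mark (e := (Sum.inr () : REdge side)) (y := v) _
    (isProbVec_rweights_leftProb ends side v w hp) _ h12 h13 h23 ho1 ho2 ho3 hob hb1 hb2 hb3 hv ?_
  rcases hwm with rfl | rfl | rfl | rfl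
  · exact Or.inl ⟨hpend, hne, hleaf⟩
  · exact Or.inr (Or.inl ⟨hpend, hne, hleaf⟩)
  · exact Or.inr (Or.inr (Or.inl ⟨hpend, hne, hleaf⟩))
  · exact Or.inr (Or.inr (Or.inr ⟨hpend, hne, hleaf⟩))

end Marked

end CutOneFarAny

end Summit.Ventures.PercRepro2
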